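import Literature.Barriers.CriticalPhenomena.WeaklySAWFlowTheorem
import HarnessLib

/-!
# [BBS-rg-flow, Lemma 3.4 (first-order, Lipschitz form)]: the base flow `x̄(g₀) = (K̄, V̄)(g₀)`
# is Lipschitz in `g₀` in the weighted norm `X^𝗐`, uniformly in the scale; transfer of the bounds
# (1.11)–(1.14) between nearby base points

File of the series formalising [BBS-rg-flow] (Bauerschmidt–Brydges–Slade, AHP 16 (2015),
arXiv:1211.2477) towards `Literature.Barriers.CriticalPhenomena.WeaklySAWFourDimLogCorrections`, for
Theorem 1.4(ii) (= BBS 2015, Theorem 7.2.1(ii)); continuation of `WeaklySAWFlowTheorem.lean` (the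
bounds (1.11)–(1.14) `FlowBounds`, `unscale`) and `WeaklySAWQuadraticFlowLipschitz.lean` ((2.33) in
Lipschitz form for `V̄ = (ḡ, z̄, μ̄)`).

Lemma 3.4 of the source bounds `‖D_{g₀}x̄‖_{X^𝗐} ≤ O(g̊₀⁻²|log g̊₀|⁻¹)`: `‖D_{g₀}V̄_j‖` by Lemma 2.3 and,
by (A3) and induction ((DgKbar-bd-2)–(DgKbar-bd)),
`‖D_{g₀}K̄_{j+1}‖ ≤ κ‖D_{g₀}K̄_j‖ + O(χ_jḡ_j²)‖D_{g₀}V̄_j‖ ≤ O(χ_jḡ_j⁴/ḡ₀²)`. In the proof of Theorem 1.4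
this is what makes the bounds (1.11)–(1.14) relative to `x̄(u₀)` follow from bounds relative to the
frozen reference `x̊ = x̄(ů₀)` for `u₀` near `ů₀` ((KKbar)–(gringgbar): "by assuming that `|ů₀ - u₀|` is
sufficiently small … `(b-δ)g̊_j²|log g̊_j²| ≤ bḡ_j²|log ḡ_j²|`"). This file proves the LIPSCHITZ form
of both statements, which is all that is used:
* scalar comparison lemmas (`abs_log_sub_log_le_of_close`, `pow_three_le_of_close`,
  `sq_mul_abs_log_le_of_close`): a relative perturbation `|u - v| ≤ ηv` costs factors `1 + O(η)` in
  `v³` and `v²|log v|`;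
* `abs_gbar_sub_gbar_le_rel` (`|ḡ_j(g) - ḡ_j(g₀)| ≤ (18|g-g₀|/g₀)·ḡ_j(g₀)`, uniformly in `j`),
  `norm_flow_sub_flow_le` (`‖V̄_j(g) - V̄_j(g₀)‖ ≤ K_V ḡ_j(g₀)²|g - g₀|/g₀²`, `flowLipConst`);
* **`norm_Kbar_sub_Kbar_le`** ((DgKbar-bd) in Lipschitz form): under (A3) along `V̄(g₀)`, Lemma 1.3
  at `g₀` and `κϑ ≤ θ < 1`, `‖K̄_j(g) - K̄_j(g₀)‖ ≤ (4MK_V|g - g₀|/(g₀(1-θ)))·χ_jḡ_j(g₀)³` for all `j`;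
* **`flowBounds_transfer`**: if `x` obeys (1.11)–(1.14) at level `b` relative to `x̄(g)`, then it obeys
  them at any level `β > b` relative to `x̄(g₀)`, provided `|g - g₀| ≤ δ` with `δ ≤ g₀/36` and
  `transferSlope·δ ≤ β - b` (`transferSlope` explicit in the constants, `g₀`, `𝗁`, `a - a_*`, `θ`).

## References
* R. Bauerschmidt, D. C. Brydges, G. Slade, *Structural stability of a dynamical system near a
  non-hyperbolic fixed point*, Ann. Henri Poincaré 16 (2015), arXiv:1211.2477: Lemma 3.4 and its
  proof ((DgVbar-bd), (DgKbar-bd-2), (DgKbar-bd)), Lemma 2.3 (2.33), proof of Theorem 1.4(i)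
  ((KKbar)–(gringgbar)). [BauerschmidtBrydgesSlade2015Flow]
* R. Bauerschmidt, D. C. Brydges, G. Slade, CMP 338 (2015), arXiv:1403.7422, Theorem 7.2.1(ii).
  [BauerschmidtBrydgesSlade2015LogCorr]
-/

noncomputable section

open Filter Topology Set
open scoped BigOperators

namespace Literature.Barriers.CriticalPhenomena

namespace CTWSAW

/-! ## Scalar comparison lemmas: a relative perturbation costs factors `1 + O(η)` -/

/-- `|u - v| ≤ ηv` with `η ≤ 1/2` gives `|log u - log v| ≤ 2η`. [folklore] -/
theorem abs_log_sub_log_le_of_close {u v η : ℝ} (hv : 0 < v) (hη0 : 0 ≤ η) (hη : η ≤ 1 / 2)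
    (huv : |u - v| ≤ η * v) : |Real.log u - Real.log v| ≤ 2 * η := by
  have h1 : (1 - η) * v ≤ u := by nlinarith [neg_abs_le (u - v)]
  have h2 : u ≤ (1 + η) * v := by nlinarith [le_abs_self (u - v)]
  have hu : 0 < u := lt_of_lt_of_le (by nlinarith) h1
  rw [← Real.log_div hu.ne' hv.ne']
  have hq1 : 1 - η ≤ u / v := by rw [le_div_iff₀ hv]; exact h1
  have hq2 : u / v ≤ 1 + η := by rw [div_le_iff₀ hv]; exact h2
  have hq0 : 0 < u / v := div_pos hu hv
  rw [abs_le]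
  constructor
  · -- `log(u/v) ≥ 1 - v/u ≥ 1 - 1/(1-η) ≥ -2η`
    have h3 := Real.one_sub_inv_le_log_of_pos hq0
    have h4 : (u / v)⁻¹ ≤ (1 - η)⁻¹ := by
      rw [inv_le_inv₀ hq0 (by linarith)]; exact hq1
    have h5 : (1 - η)⁻¹ ≤ 1 + 2 * η := by
      rw [inv_eq_one_div, div_le_iff₀ (by linarith)]; nlinarith
    linarith
  · have h3 := Real.log_le_sub_one_of_pos hq0
    linarith

/-- `|u - v| ≤ ηv` with `η ≤ 1` gives `u³ ≤ (1 + 7η)v³`. [folklore] -/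
theorem pow_three_le_of_close {u v η : ℝ} (hu : 0 ≤ u) (hv : 0 ≤ v) (hη0 : 0 ≤ η) (hη : η ≤ 1)
    (huv : |u - v| ≤ η * v) : u ^ 3 ≤ (1 + 7 * η) * v ^ 3 := by
  have h2 : u ≤ (1 + η) * v := by nlinarith [le_abs_self (u - v)]
  have h3 : u ^ 3 ≤ ((1 + η) * v) ^ 3 := pow_le_pow_left₀ hu h2 3
  have h4 : (1 + η) ^ 3 ≤ 1 + 7 * η := by
    have hη2 : η ^ 2 ≤ η := by nlinarith
    have hη3 : η ^ 3 ≤ η := by nlinarith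
    nlinarith
  calc u ^ 3 ≤ ((1 + η) * v) ^ 3 := h3
    _ = (1 + η) ^ 3 * v ^ 3 := by ring
    _ ≤ (1 + 7 * η) * v ^ 3 := by gcongr

/-- `|u - v| ≤ ηv` with `η ≤ 1/2` and `|log v| ≥ 1/2` gives `u²|log u| ≤ (1 + 13η)v²|log v|`. [folklore] -/
theorem sq_mul_abs_log_le_of_close {u v η : ℝ} (hv : 0 < v) (hη0 : 0 ≤ η) (hη : η ≤ 1 / 2)
    (hlog : 1 / 2 ≤ |Real.log v|) (huv : |u - v| ≤ η * v) :
    u ^ 2 * |Real.log u| ≤ (1 + 13 * η) * (v ^ 2 * |Real.log v|) := by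
  have h1 : (1 - η) * v ≤ u := by nlinarith [neg_abs_le (u - v)]
  have h2 : u ≤ (1 + η) * v := by nlinarith [le_abs_self (u - v)]
  have hu : 0 ≤ u := le_trans (by nlinarith) h1
  have hsq : u ^ 2 ≤ (1 + 3 * η) * v ^ 2 := by
    have h' : u ^ 2 ≤ ((1 + η) * v) ^ 2 := pow_le_pow_left₀ hu h2 2
    have hη2 : (1 + η) ^ 2 ≤ 1 + 3 * η := by nlinarith
    have hv2 : 0 ≤ v ^ 2 := sq_nonneg v
    calc u ^ 2 ≤ ((1 + η) * v) ^ 2 := h'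
      _ = (1 + η) ^ 2 * v ^ 2 := by ring
      _ ≤ (1 + 3 * η) * v ^ 2 := mul_le_mul_of_nonneg_right hη2 hv2
  have hl := abs_log_sub_log_le_of_close hv hη0 hη huv
  have hlog' : |Real.log u| ≤ (1 + 4 * η) * |Real.log v| := by
    have : |Real.log u| ≤ |Real.log v| + 2 * η := by
      have := abs_sub_abs_le_abs_sub (Real.log u) (Real.log v); linarith
    nlinarith
  have hL : 0 ≤ |Real.log v| := abs_nonneg _
  calc u ^ 2 * |Real.log u| ≤ ((1 + 3 * η) * v ^ 2) * ((1 + 4 * η) * |Real.log v|) :=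
        mul_le_mul hsq hlog' (abs_nonneg _) (by positivity)
    _ = (1 + 7 * η + 12 * η ^ 2) * (v ^ 2 * |Real.log v|) := by ring
    _ ≤ (1 + 13 * η) * (v ^ 2 * |Real.log v|) := by
        apply mul_le_mul_of_nonneg_right _ (by positivity)
        nlinarith

/-! ## The `𝒱`-components: `V̄_j` is Lipschitz in `g₀`, relatively to the weights, uniformly in `j` -/

/-- The Lipschitz constant `K_V = max(9, K_z, K_μ)` of `‖V̄_j(g) - V̄_j(g₀)‖ ≤ K_Vḡ_j(g₀)²|g - g₀|/g₀²`.
[cite: BauerschmidtBrydgesSlade2015Flow, Lemma 2.3, (2.33) and Lemma 3.4, (DgVbar-bd)] -/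
def flowLipConst (Ω c : ℝ) (N : ℕ) (C lam : ℝ) : ℝ := max 9 (max (zLipConst Ω c N C) (muLipConst Ω c N C lam))

/-- The slope of the transfer of the bounds (1.11)–(1.14) from the base point `g` to the base point
`g₀`: `|g - g₀| ≤ δ` with `transferSlope·δ ≤ β - b` (and `δ ≤ g₀/36`) turns level `b` at `g` into level
`β` at `g₀`. [cite: BauerschmidtBrydgesSlade2015Flow, Theorem 1.4(i) (proof, (KKbar)–(gringgbar)) and Remark 1.5] -/
def transferSlope (Ω c : ℝ) (N : ℕ) (C lam g₀ M hh aK θ b : ℝ) : ℝ :=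
  13 * 18 * b / g₀ + 4 * M * flowLipConst Ω c N C lam / (g₀ * (1 - θ) * aK) +
    (18 + 2 * flowLipConst Ω c N C lam) / (g₀ ^ 2 * hh)

namespace CutoffQuadHyp

variable {P : QuadFlowParams} {Ω : ℝ} {k : ℕ∞} {B c : ℝ} {N : ℕ} {C lam g₀ : ℝ}
  (h : CutoffQuadHyp P Ω k B c N C lam g₀)
include h

omit h in
/-- `K_V ≥ 9 ≥ 0`, `K_V ≥ K_z`, `K_V ≥ K_μ`. [cite: BauerschmidtBrydgesSlade2015Flow, Lemma 2.3, (2.33)] -/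
theorem flowLipConst_ge : 9 ≤ flowLipConst Ω c N C lam ∧ zLipConst Ω c N C ≤ flowLipConst Ω c N C lam ∧
    muLipConst Ω c N C lam ≤ flowLipConst Ω c N C lam :=
  ⟨le_max_left _ _, (le_max_left _ _).trans (le_max_right _ _), (le_max_right _ _).trans (le_max_right _ _)⟩

/-- **`|ḡ_j(g) - ḡ_j(g₀)| ≤ (18|g - g₀|/g₀)·ḡ_j(g₀)`**, uniformly in `j` (from (2.33) for `ḡ` in Lipschitz
form and `ḡ_j(g₀) ≤ 2g₀`). [cite: BauerschmidtBrydgesSlade2015Flow, Lemma 2.3, (2.33) and Lemma 3.4, (3.14)] -/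
theorem abs_gbar_sub_gbar_le_rel {g : ℝ} (hg : 0 < g) (hmax : CutoffQuadHyp P Ω k B c N C lam (max g g₀))
    (hsmall : 8 * B ^ 2 * ((1 + N) / c + N + 2 * Ω / (Ω - 1)) * max g g₀ ≤ 1) {δ : ℝ}
    (hδ : |g - g₀| ≤ δ) (hδ1 : δ ≤ g₀ / 36) (j : ℕ) :
    |gbar P.β g j - gbar P.β g₀ j| ≤ 18 * δ / g₀ * gbar P.β g₀ j := by
  have h' : CutoffQuadHyp P Ω k B c N C lam g := hmax.mono hg (le_max_left _ _)
  have hg₀ := h.g₀_pos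
  have hclose : |g - g₀| ≤ g₀ / 4 := hδ.trans (by linarith)
  have hΔ := h'.toCutoffGbarHyp.abs_gbar_sub_gbar_le_sq h.toCutoffGbarHyp hmax.toCutoffGbarHyp hsmall hclose j
  have h2 := h.gbar_le_two_mul_init j
  have hgj := (h.gbar_pos j).le
  have hδ0 : 0 ≤ δ := (abs_nonneg _).trans hδ
  calc |gbar P.β g j - gbar P.β g₀ j| ≤ 9 * (gbar P.β g₀ j ^ 2 / g₀ ^ 2) * |g - g₀| := hΔ
    _ = 9 * (gbar P.β g₀ j / g₀ ^ 2) * |g - g₀| * gbar P.β g₀ j := by ring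
    _ ≤ 9 * (2 * g₀ / g₀ ^ 2) * δ * gbar P.β g₀ j := by gcongr
    _ = 18 * δ / g₀ * gbar P.β g₀ j := by field_simp; ring

/-- **(2.33) in Lipschitz form, all three components**: `|ḡ_j(g) - ḡ_j(g₀)| ≤ 9(ḡ_j(g₀)²/g₀²)δ`,
`|z̄_j(g) - z̄_j(g₀)| ≤ K_zχ_jḡ_j(g₀)²δ/g₀²`, `|μ̄_j(g) - μ̄_j(g₀)| ≤ K_μχ_jḡ_j(g₀)²δ/g₀²` for `|g - g₀| ≤ δ ≤ g₀/36`.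
[cite: BauerschmidtBrydgesSlade2015Flow, Lemma 2.3, (2.33)] -/
theorem abs_flow_sub_flow_le {g : ℝ} (hg : 0 < g) (hmax : CutoffQuadHyp P Ω k B c N C lam (max g g₀))
    (hsmall : 8 * B ^ 2 * ((1 + N) / c + N + 2 * Ω / (Ω - 1)) * max g g₀ ≤ 1) {δ : ℝ}
    (hδ : |g - g₀| ≤ δ) (hδ1 : δ ≤ g₀ / 36) (j : ℕ) :
    |P.flow g j 0 - P.flow g₀ j 0| ≤ 9 * (gbar P.β g₀ j ^ 2 / g₀ ^ 2) * δ ∧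
      |P.flow g j 1 - P.flow g₀ j 1| ≤ zLipConst Ω c N C * (cutoffWeight Ω k j * gbar P.β g₀ j ^ 2) * (δ / g₀ ^ 2) ∧
      |P.flow g j 2 - P.flow g₀ j 2| ≤ muLipConst Ω c N C lam * (cutoffWeight Ω k j * gbar P.β g₀ j ^ 2) * (δ / g₀ ^ 2) := by
  have h' : CutoffQuadHyp P Ω k B c N C lam g := hmax.mono hg (le_max_left _ _)
  have hg₀ := h.g₀_pos
  have hclose : |g - g₀| ≤ g₀ / 4 := hδ.trans (by linarith)
  have hδ0 : 0 ≤ δ := (abs_nonneg _).trans hδ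
  have hKz := h.zLipConst_nonneg; have hKμ := h.muLipConst_nonneg
  have hw := (h.weight_pos j).le; have hgj := (h.gbar_pos j).le
  refine ⟨?_, ?_, ?_⟩
  · rw [QuadFlowParams.flow_apply_zero, QuadFlowParams.flow_apply_zero]
    have hΔ := h'.toCutoffGbarHyp.abs_gbar_sub_gbar_le_sq h.toCutoffGbarHyp hmax.toCutoffGbarHyp hsmall hclose j
    exact hΔ.trans (by gcongr)
  · rw [QuadFlowParams.flow_apply_one, QuadFlowParams.flow_apply_one]
    have hΔ := h.abs_zbar_sub_zbar_le hg hmax hsmall hclose j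
    exact hΔ.trans (by gcongr)
  · rw [QuadFlowParams.flow_apply_two, QuadFlowParams.flow_apply_two]
    have hΔ := h.abs_mubar_sub_mubar_le hg hmax hsmall hclose j
    exact hΔ.trans (by gcongr)

/-- **`‖V̄_j(g) - V̄_j(g₀)‖ ≤ K_V ḡ_j(g₀)² δ/g₀²`** for `|g - g₀| ≤ δ ≤ g₀/36` ((DgVbar-bd) in Lipschitz form,
sup norm on `ℝ³`, `χ_j ≤ 1`). [cite: BauerschmidtBrydgesSlade2015Flow, Lemma 3.4, (DgVbar-bd) and Lemma 2.3, (2.33)] -/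
theorem norm_flow_sub_flow_le {g : ℝ} (hg : 0 < g) (hmax : CutoffQuadHyp P Ω k B c N C lam (max g g₀))
    (hsmall : 8 * B ^ 2 * ((1 + N) / c + N + 2 * Ω / (Ω - 1)) * max g g₀ ≤ 1) {δ : ℝ}
    (hδ : |g - g₀| ≤ δ) (hδ1 : δ ≤ g₀ / 36) (j : ℕ) :
    ‖P.flow g j - P.flow g₀ j‖ ≤ flowLipConst Ω c N C lam * gbar P.β g₀ j ^ 2 * (δ / g₀ ^ 2) := by
  obtain ⟨h0, h1, h2⟩ := h.abs_flow_sub_flow_le hg hmax hsmall hδ hδ1 j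
  obtain ⟨hK9, hKz, hKμ⟩ := flowLipConst_ge (Ω := Ω) (c := c) (N := N) (C := C) (lam := lam)
  have hδ0 : 0 ≤ δ := (abs_nonneg _).trans hδ
  have hg₀ := h.g₀_pos
  have hw := (h.weight_pos j).le; have hw1 := h.weight_le_one j; have hgj := (h.gbar_pos j).le
  have hK0 : 0 ≤ flowLipConst Ω c N C lam := le_trans (by norm_num) hK9
  have hq : 0 ≤ gbar P.β g₀ j ^ 2 * (δ / g₀ ^ 2) := by positivity
  refine norm_V3_le (by positivity) ?_ ?_ ?_
  · rw [Pi.sub_apply]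
    calc _ ≤ 9 * (gbar P.β g₀ j ^ 2 / g₀ ^ 2) * δ := h0
      _ = 9 * (gbar P.β g₀ j ^ 2 * (δ / g₀ ^ 2)) := by ring
      _ ≤ flowLipConst Ω c N C lam * (gbar P.β g₀ j ^ 2 * (δ / g₀ ^ 2)) := mul_le_mul_of_nonneg_right hK9 hq
      _ = _ := by ring
  · rw [Pi.sub_apply]
    calc _ ≤ zLipConst Ω c N C * (cutoffWeight Ω k j * gbar P.β g₀ j ^ 2) * (δ / g₀ ^ 2) := h1
      _ ≤ flowLipConst Ω c N C lam * (1 * gbar P.β g₀ j ^ 2) * (δ / g₀ ^ 2) := by gcongr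
      _ = _ := by ring
  · rw [Pi.sub_apply]
    calc _ ≤ muLipConst Ω c N C lam * (cutoffWeight Ω k j * gbar P.β g₀ j ^ 2) * (δ / g₀ ^ 2) := h2
      _ ≤ flowLipConst Ω c N C lam * (1 * gbar P.β g₀ j ^ 2) * (δ / g₀ ^ 2) := by gcongr
      _ = _ := by ring

/-! ## The `𝒦`-component: `K̄_j` is Lipschitz in `g₀` in the weight `χ_jḡ_j³`, uniformly in `j`
((DgKbar-bd) in Lipschitz form) -/

variable {W : ℕ → Type*} [∀ j, NormedAddCommGroup (W j)] [∀ j, NormedSpace ℝ (W j)]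
  {ψ : ∀ j, W j × V3 → W (j + 1)} {ρ : ∀ j, W j × V3 → V3} {a hh κ R M aStar : ℝ} {K₀ : W 0}

/-- **[BBS-rg-flow, Lemma 3.4, (DgKbar-bd), Lipschitz form]**: under (A3) along `V̄(g₀)`, Lemma 1.3 at
`g₀` (`‖K̄_j(g₀)‖ ≤ a_*χ_jḡ_j³`) and `κϑ ≤ θ < 1`, for `|g - g₀| ≤ δ ≤ g₀/36` with
`A = 4MK_Vδ/(g₀(1-θ)) ≤ a - a_*` and `K_Vδ/g₀² ≤ 𝗁/2`,
`‖K̄_j(g) - K̄_j(g₀)‖ ≤ A·χ_jḡ_j(g₀)³` for all `j` — by induction: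
`‖ΔK̄_{j+1}‖ ≤ κ‖ΔK̄_j‖ + Mχ_{j+1}ḡ_{j+1}²‖ΔV̄_j‖ ≤ (κϑA + 4MK_Vδ/g₀)χ_{j+1}ḡ_{j+1}³ = Aχ_{j+1}ḡ_{j+1}³`.
[cite: BauerschmidtBrydgesSlade2015Flow, Lemma 3.4, (DgKbar-bd-2)–(DgKbar-bd)] -/
theorem norm_Kbar_sub_Kbar_le (hA : HypA3 (cutoffWeight Ω k) ψ ρ (P.flow g₀) a hh κ Ω R M) (hh0 : 0 < hh)
    (haS : aStar < a)
    (hKbar : ∀ j, ‖Kbar ψ (P.flow g₀) K₀ j‖ ≤ aStar * cutoffWeight Ω k j * gbar P.β g₀ j ^ 3)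
    {θ : ℝ} (hθ : κ * stepRatio Ω B g₀ ≤ θ) (hθ1 : θ < 1)
    {g : ℝ} (hg : 0 < g) (hmax : CutoffQuadHyp P Ω k B c N C lam (max g g₀))
    (hsmall : 8 * B ^ 2 * ((1 + N) / c + N + 2 * Ω / (Ω - 1)) * max g g₀ ≤ 1) {δ : ℝ}
    (hδ : |g - g₀| ≤ δ) (hδ1 : δ ≤ g₀ / 36)
    (hAle : 4 * M * flowLipConst Ω c N C lam * δ / (g₀ * (1 - θ)) ≤ a - aStar)
    (hVle : flowLipConst Ω c N C lam * δ / g₀ ^ 2 ≤ hh / 2) (j : ℕ) :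
    ‖Kbar ψ (P.flow g) K₀ j - Kbar ψ (P.flow g₀) K₀ j‖ ≤
      4 * M * flowLipConst Ω c N C lam * δ / (g₀ * (1 - θ)) * (cutoffWeight Ω k j * gbar P.β g₀ j ^ 3) := by
  set A : ℝ := 4 * M * flowLipConst Ω c N C lam * δ / (g₀ * (1 - θ)) with hA_def
  set KV : ℝ := flowLipConst Ω c N C lam with hKV
  have hg₀ := h.g₀_pos
  have hM := hA.M_pos.le; have hκ := hA.κ_pos.le
  have hδ0 : 0 ≤ δ := (abs_nonneg _).trans hδ
  obtain ⟨hK9, -, -⟩ := flowLipConst_ge (Ω := Ω) (c := c) (N := N) (C := C) (lam := lam)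
  have hKV0 : 0 ≤ KV := le_trans (by norm_num) hK9
  have h1θ : 0 < 1 - θ := by linarith
  have hA0 : 0 ≤ A := by rw [hA_def]; positivity
  have hχ : ∀ j, 0 ≤ cutoffWeight Ω k j := fun j => (h.weight_pos j).le
  have hϑ := h.stepRatio_nonneg
  -- the `𝒱`-difference and the domain condition for `x̄_j(g)` in `D_j(g₀)`
  have hV : ∀ j, ‖P.flow g j - P.flow g₀ j‖ ≤ KV * gbar P.β g₀ j ^ 2 * (δ / g₀ ^ 2) := fun j =>
    h.norm_flow_sub_flow_le hg hmax hsmall hδ hδ1 j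
  have hxD : ∀ j (K : W j), ‖K‖ ≤ a * cutoffWeight Ω k j * gbar P.β g₀ j ^ 3 →
      (K, P.flow g j) ∈ flowDomain (cutoffWeight Ω k) (P.flow g₀) a hh j := by
    intro j K hK
    obtain ⟨h0', h1', h2'⟩ := h.abs_flow_sub_flow_le hg hmax hsmall hδ hδ1 j
    obtain ⟨hK9', hKz', hKμ'⟩ := flowLipConst_ge (Ω := Ω) (c := c) (N := N) (C := C) (lam := lam)
    have hL := h.half_le_abs_log_gbar j
    have hw := hχ j; have hgj := (h.gbar_pos j).le
    have hq : 0 ≤ cutoffWeight Ω k j * gbar P.β g₀ j ^ 2 := by positivity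
    have hgen : ∀ {t K' : ℝ}, |t| ≤ K' * (cutoffWeight Ω k j * gbar P.β g₀ j ^ 2) * (δ / g₀ ^ 2) → K' ≤ KV →
        |t| ≤ hh * cutoffWeight Ω k j * gbar P.β g₀ j ^ 2 * |Real.log (gbar P.β g₀ j)| := by
      intro t K' ht hK'
      calc |t| ≤ K' * (cutoffWeight Ω k j * gbar P.β g₀ j ^ 2) * (δ / g₀ ^ 2) := ht
        _ ≤ KV * (cutoffWeight Ω k j * gbar P.β g₀ j ^ 2) * (δ / g₀ ^ 2) := by gcongr
        _ = (KV * δ / g₀ ^ 2) * (cutoffWeight Ω k j * gbar P.β g₀ j ^ 2) := by ring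
        _ ≤ (hh / 2) * (cutoffWeight Ω k j * gbar P.β g₀ j ^ 2) := mul_le_mul_of_nonneg_right hVle hq
        _ = hh * cutoffWeight Ω k j * gbar P.β g₀ j ^ 2 * (1 / 2) := by ring
        _ ≤ hh * cutoffWeight Ω k j * gbar P.β g₀ j ^ 2 * |Real.log (gbar P.β g₀ j)| := by gcongr
    refine ⟨?_, ?_, ?_, ?_⟩
    · simpa only [QuadFlowParams.flow_apply_zero] using hK
    · rw [QuadFlowParams.flow_apply_zero]
      calc |P.flow g j 0 - P.flow g₀ j 0| ≤ 9 * (gbar P.β g₀ j ^ 2 / g₀ ^ 2) * δ := h0'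
        _ ≤ KV * (gbar P.β g₀ j ^ 2 / g₀ ^ 2) * δ := by gcongr
        _ = (KV * δ / g₀ ^ 2) * gbar P.β g₀ j ^ 2 := by ring
        _ ≤ (hh / 2) * gbar P.β g₀ j ^ 2 := mul_le_mul_of_nonneg_right hVle (by positivity)
        _ = hh * gbar P.β g₀ j ^ 2 * (1 / 2) := by ring
        _ ≤ hh * gbar P.β g₀ j ^ 2 * |Real.log (gbar P.β g₀ j)| := by gcongr
    · rw [QuadFlowParams.flow_apply_zero]; exact hgen h1' hKz'
    · rw [QuadFlowParams.flow_apply_zero]; exact hgen h2' hKμ'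
  -- the induction
  induction j with
  | zero => simp only [Kbar_zero, sub_self, norm_zero]; have := hχ 0; have := (h.gbar_pos 0).le; positivity
  | succ j ih =>
    rw [Kbar_succ, Kbar_succ]
    have hw := hχ j; have hw' := hχ (j + 1); have hgj := (h.gbar_pos j).le; have hgj' := (h.gbar_pos (j + 1)).le
    -- both points lie in `D_j(g₀)`
    have hx0 : (Kbar ψ (P.flow g₀) K₀ j, P.flow g₀ j) ∈ flowDomain (cutoffWeight Ω k) (P.flow g₀) a hh j := by
      have := h.baseX_mem_flowDomain (ψ := ψ) (K₀ := K₀) hh0.le (by linarith : 0 ≤ a - aStar) j (hKbar j)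
      simpa only [baseX] using this
    have hKg : ‖Kbar ψ (P.flow g) K₀ j‖ ≤ a * cutoffWeight Ω k j * gbar P.β g₀ j ^ 3 := by
      calc ‖Kbar ψ (P.flow g) K₀ j‖
          ≤ ‖Kbar ψ (P.flow g₀) K₀ j‖ + ‖Kbar ψ (P.flow g) K₀ j - Kbar ψ (P.flow g₀) K₀ j‖ := norm_le_insert' _ _
        _ ≤ aStar * cutoffWeight Ω k j * gbar P.β g₀ j ^ 3 + A * (cutoffWeight Ω k j * gbar P.β g₀ j ^ 3) :=
            add_le_add (hKbar j) ih
        _ = (aStar + A) * (cutoffWeight Ω k j * gbar P.β g₀ j ^ 3) := by ring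
        _ ≤ a * (cutoffWeight Ω k j * gbar P.β g₀ j ^ 3) := by
            refine mul_le_mul_of_nonneg_right ?_ (by positivity); linarith
        _ = _ := by ring
    have hx1 : (Kbar ψ (P.flow g) K₀ j, P.flow g j) ∈ flowDomain (cutoffWeight Ω k) (P.flow g₀) a hh j := hxD j _ hKg
    have hL := hA.norm_ψ_sub_ψ_le hχ j hx1 hx0
    rw [QuadFlowParams.flow_apply_zero] at hL
    -- one-step weight ratios
    have hcube : cutoffWeight Ω k j * gbar P.β g₀ j ^ 3 ≤
        stepRatio Ω B g₀ * (cutoffWeight Ω k (j + 1) * gbar P.β g₀ (j + 1) ^ 3) :=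
      h.toCutoffGbarHyp.weight_cube_le_mul_succ j
    have hsq : gbar P.β g₀ j ^ 2 ≤ 4 * g₀ * gbar P.β g₀ (j + 1) := by
      have h1 : gbar P.β g₀ j ≤ 2 * gbar P.β g₀ (j + 1) := by linarith [(h.gbar_succ_mem j).1]
      have h2 := h.gbar_le_two_mul_init j
      nlinarith
    -- assemble
    have hθA : κ * (A * (cutoffWeight Ω k j * gbar P.β g₀ j ^ 3)) ≤
        θ * A * (cutoffWeight Ω k (j + 1) * gbar P.β g₀ (j + 1) ^ 3) := by
      calc κ * (A * (cutoffWeight Ω k j * gbar P.β g₀ j ^ 3))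
          ≤ κ * (A * (stepRatio Ω B g₀ * (cutoffWeight Ω k (j + 1) * gbar P.β g₀ (j + 1) ^ 3))) := by gcongr
        _ = (κ * stepRatio Ω B g₀) * A * (cutoffWeight Ω k (j + 1) * gbar P.β g₀ (j + 1) ^ 3) := by ring
        _ ≤ θ * A * (cutoffWeight Ω k (j + 1) * gbar P.β g₀ (j + 1) ^ 3) := by gcongr
    have hVA : M * cutoffWeight Ω k (j + 1) * gbar P.β g₀ (j + 1) ^ 2 * (KV * gbar P.β g₀ j ^ 2 * (δ / g₀ ^ 2)) ≤
        (1 - θ) * A * (cutoffWeight Ω k (j + 1) * gbar P.β g₀ (j + 1) ^ 3) := by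
      calc M * cutoffWeight Ω k (j + 1) * gbar P.β g₀ (j + 1) ^ 2 * (KV * gbar P.β g₀ j ^ 2 * (δ / g₀ ^ 2))
          ≤ M * cutoffWeight Ω k (j + 1) * gbar P.β g₀ (j + 1) ^ 2 * (KV * (4 * g₀ * gbar P.β g₀ (j + 1)) * (δ / g₀ ^ 2)) := by
            gcongr
        _ = (4 * M * KV * δ / g₀) * (cutoffWeight Ω k (j + 1) * gbar P.β g₀ (j + 1) ^ 3) := by
            field_simp
        _ = (1 - θ) * A * (cutoffWeight Ω k (j + 1) * gbar P.β g₀ (j + 1) ^ 3) := by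
            rw [hA_def]; field_simp
    calc ‖ψ j (Kbar ψ (P.flow g) K₀ j, P.flow g j) - ψ j (Kbar ψ (P.flow g₀) K₀ j, P.flow g₀ j)‖
        ≤ κ * ‖Kbar ψ (P.flow g) K₀ j - Kbar ψ (P.flow g₀) K₀ j‖ +
            M * cutoffWeight Ω k (j + 1) * gbar P.β g₀ (j + 1) ^ 2 * ‖P.flow g j - P.flow g₀ j‖ := hL
      _ ≤ κ * (A * (cutoffWeight Ω k j * gbar P.β g₀ j ^ 3)) +
            M * cutoffWeight Ω k (j + 1) * gbar P.β g₀ (j + 1) ^ 2 * (KV * gbar P.β g₀ j ^ 2 * (δ / g₀ ^ 2)) :=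
          add_le_add (mul_le_mul_of_nonneg_left ih hκ) (mul_le_mul_of_nonneg_left (hV j) (by positivity))
      _ ≤ θ * A * (cutoffWeight Ω k (j + 1) * gbar P.β g₀ (j + 1) ^ 3) +
            (1 - θ) * A * (cutoffWeight Ω k (j + 1) * gbar P.β g₀ (j + 1) ^ 3) := add_le_add hθA hVA
      _ = A * (cutoffWeight Ω k (j + 1) * gbar P.β g₀ (j + 1) ^ 3) := by ring

/-! ## Transfer of the bounds (1.11)–(1.14) from the base point `g` (level `b`) to the base point
`g₀` (level `β > b`) -/

/-- The three (nonnegative) parts of `transferSlope`. [cite: BauerschmidtBrydgesSlade2015Flow, Theorem 1.4(i) (proof, (KKbar)–(gringgbar))] -/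
theorem transferSlope_parts {M hh aK θ b : ℝ} (hM : 0 ≤ M) (hh0 : 0 < hh) (haK : 0 < aK) (hθ1 : θ < 1) (hb : 0 ≤ b) :
    0 ≤ 13 * 18 * b / g₀ ∧ 0 ≤ 4 * M * flowLipConst Ω c N C lam / (g₀ * (1 - θ) * aK) ∧
      0 ≤ (18 + 2 * flowLipConst Ω c N C lam) / (g₀ ^ 2 * hh) ∧
      transferSlope Ω c N C lam g₀ M hh aK θ b = 13 * 18 * b / g₀ +
        4 * M * flowLipConst Ω c N C lam / (g₀ * (1 - θ) * aK) + (18 + 2 * flowLipConst Ω c N C lam) / (g₀ ^ 2 * hh) := by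
  have hg₀ := h.g₀_pos
  obtain ⟨hK9, -, -⟩ := flowLipConst_ge (Ω := Ω) (c := c) (N := N) (C := C) (lam := lam)
  have hK0 : 0 ≤ flowLipConst Ω c N C lam := le_trans (by norm_num) hK9
  have : 0 < 1 - θ := by linarith
  exact ⟨by positivity, by positivity, by positivity, rfl⟩

/-- **Transfer of the bounds (1.11)–(1.14) between nearby base points**: if `x` obeys (1.11)–(1.14) at
level `b` relative to `x̄(g) = (K̄(g), V̄(g))` (weights at `g`), and `|g - g₀| ≤ δ` with `δ ≤ g₀/36`,
`transferSlope·δ ≤ β - b` (`0 ≤ b`, `β ≤ 1`), then `x` obeys (1.11)–(1.14) at level `β` relative to `x̄(g₀)`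
(weights at `g₀`) — the step "(KKbar)–(gringgbar)" of the printed proof of Theorem 1.4 (there with
`x̊` frozen and `u₀` moving; the roles are symmetric). Requires (A3) along `V̄(g₀)`, Lemma 1.3 at `g₀`
and `κϑ ≤ θ < 1`. [cite: BauerschmidtBrydgesSlade2015Flow, Theorem 1.4(i) (proof, (KKbar)–(gringgbar)) and Lemma 3.4] -/
theorem flowBounds_transfer (hA : HypA3 (cutoffWeight Ω k) ψ ρ (P.flow g₀) a hh κ Ω R M) (hh0 : 0 < hh)
    (haS : aStar < a)
    (hKbar : ∀ j, ‖Kbar ψ (P.flow g₀) K₀ j‖ ≤ aStar * cutoffWeight Ω k j * gbar P.β g₀ j ^ 3)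
    {θ : ℝ} (hθ : κ * stepRatio Ω B g₀ ≤ θ) (hθ1 : θ < 1)
    {g : ℝ} (hg : 0 < g) (hmax : CutoffQuadHyp P Ω k B c N C lam (max g g₀))
    (hsmall : 8 * B ^ 2 * ((1 + N) / c + N + 2 * Ω / (Ω - 1)) * max g g₀ ≤ 1) {δ : ℝ}
    (hδ : |g - g₀| ≤ δ) (hδ1 : δ ≤ g₀ / 36) {b β : ℝ} (hb0 : 0 ≤ b) (hβ1 : β ≤ 1)
    (hL : transferSlope Ω c N C lam g₀ M hh (a - aStar) θ b * δ ≤ β - b)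
    {x : ∀ j, W j × V3} (hx : FlowBounds (cutoffWeight Ω k) ψ (P.flow g) K₀ a aStar hh b x) :
    FlowBounds (cutoffWeight Ω k) ψ (P.flow g₀) K₀ a aStar hh β x := by
  have h' : CutoffQuadHyp P Ω k B c N C lam g := hmax.mono hg (le_max_left _ _)
  have hg₀ := h.g₀_pos
  have haK : 0 < a - aStar := by linarith
  have hM := hA.M_pos.le
  have hδ0 : 0 ≤ δ := (abs_nonneg _).trans hδ
  set KV : ℝ := flowLipConst Ω c N C lam with hKV
  obtain ⟨hK9, hKz, hKμ⟩ := flowLipConst_ge (Ω := Ω) (c := c) (N := N) (C := C) (lam := lam)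
  have hKV0 : 0 ≤ KV := le_trans (by norm_num) hK9
  obtain ⟨hs1, hs2, hs3, hLeq⟩ := h.transferSlope_parts (lam := lam) hM hh0 haK hθ1 hb0
  -- the three slope inequalities
  have h1θ : 0 < 1 - θ := by linarith
  have hS1 : 13 * 18 * b / g₀ * δ ≤ β - b := by
    have : 13 * 18 * b / g₀ * δ ≤ transferSlope Ω c N C lam g₀ M hh (a - aStar) θ b * δ := by
      rw [hLeq]; apply mul_le_mul_of_nonneg_right _ hδ0; linarith only [hs2, hs3]
    exact this.trans hL
  have hS2 : 4 * M * KV / (g₀ * (1 - θ) * (a - aStar)) * δ ≤ β - b := by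
    have : 4 * M * KV / (g₀ * (1 - θ) * (a - aStar)) * δ ≤ transferSlope Ω c N C lam g₀ M hh (a - aStar) θ b * δ := by
      rw [hLeq]; apply mul_le_mul_of_nonneg_right _ hδ0; linarith only [hs1, hs3]
    exact this.trans hL
  have hS3 : (18 + 2 * KV) / (g₀ ^ 2 * hh) * δ ≤ β - b := by
    have : (18 + 2 * KV) / (g₀ ^ 2 * hh) * δ ≤ transferSlope Ω c N C lam g₀ M hh (a - aStar) θ b * δ := by
      rw [hLeq]; apply mul_le_mul_of_nonneg_right _ hδ0; linarith only [hs1, hs2]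
    exact this.trans hL
  have hS13 : 13 * 18 * b / g₀ * δ + (18 + 2 * KV) / (g₀ ^ 2 * hh) * δ ≤ β - b := by
    have h2 : 0 ≤ 4 * M * KV / (g₀ * (1 - θ) * (a - aStar)) * δ := mul_nonneg hs2 hδ0
    have : 13 * 18 * b / g₀ * δ + (18 + 2 * KV) / (g₀ ^ 2 * hh) * δ ≤
        transferSlope Ω c N C lam g₀ M hh (a - aStar) θ b * δ := by
      rw [hLeq, add_mul, add_mul]; linarith only [h2]
    exact this.trans hL
  have hS12 : 13 * 18 * b / g₀ * δ + 4 * M * KV / (g₀ * (1 - θ) * (a - aStar)) * δ ≤ β - b := by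
    have h3 : 0 ≤ (18 + 2 * KV) / (g₀ ^ 2 * hh) * δ := mul_nonneg hs3 hδ0
    have : 13 * 18 * b / g₀ * δ + 4 * M * KV / (g₀ * (1 - θ) * (a - aStar)) * δ ≤
        transferSlope Ω c N C lam g₀ M hh (a - aStar) θ b * δ := by
      rw [hLeq, add_mul, add_mul]; linarith only [h3]
    exact this.trans hL
  -- the hypotheses of `norm_Kbar_sub_Kbar_le`
  set A : ℝ := 4 * M * KV * δ / (g₀ * (1 - θ)) with hA_def
  have hAeq : A = 4 * M * KV / (g₀ * (1 - θ) * (a - aStar)) * δ * (a - aStar) := by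
    rw [hA_def]; field_simp
  have hA0 : 0 ≤ A := by rw [hA_def]; positivity
  have hAle : A ≤ a - aStar := by
    rw [hAeq]
    calc _ ≤ (β - b) * (a - aStar) := mul_le_mul_of_nonneg_right hS2 haK.le
      _ ≤ 1 * (a - aStar) := by gcongr; linarith
      _ = _ := one_mul _
  have hVle : KV * δ / g₀ ^ 2 ≤ hh / 2 := by
    have h3 : (18 + 2 * KV) / (g₀ ^ 2 * hh) * δ ≤ 1 := hS3.trans (by linarith only [hβ1, hb0])
    rw [div_mul_eq_mul_div, div_le_one (by positivity)] at h3
    rw [div_le_iff₀ (by positivity)]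
    have hg2 : 0 < g₀ ^ 2 := by positivity
    nlinarith only [h3, hδ0, hg2, hh0, hKV0]
  have hKΔ := fun j => h.norm_Kbar_sub_Kbar_le hA hh0 haS hKbar hθ hθ1 hg hmax hsmall hδ hδ1 hAle hVle j
  -- the relative comparison of `ḡ_j(g)` with `ḡ_j(g₀)`
  set η : ℝ := 18 * δ / g₀ with hη
  have hη0 : 0 ≤ η := by rw [hη]; positivity
  have hη2 : η ≤ 1 / 2 := by rw [hη, div_le_iff₀ hg₀]; linarith
  have hrel := fun j => h.abs_gbar_sub_gbar_le_rel hg hmax hsmall hδ hδ1 j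
  have hΔV := fun j => h.abs_flow_sub_flow_le hg hmax hsmall hδ hδ1 j
  -- `ηb`-terms against the slope
  have hηb : 13 * η * b = 13 * 18 * b / g₀ * δ := by rw [hη]; ring
  intro j
  obtain ⟨b1, b2, b3, b4⟩ := hx j
  simp only [QuadFlowParams.flow_apply_zero] at b1 b2 b3 b4 ⊢
  have hw := (h.weight_pos j).le; have hw1 := h.weight_le_one j
  have hgj := h.gbar_pos j; have hgj' := (h'.gbar_pos j).le
  have hlog := h.half_le_abs_log_gbar j
  have hcube := pow_three_le_of_close hgj' hgj.le hη0 (by linarith) (hrel j)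
  have hsqlog := sq_mul_abs_log_le_of_close hgj hη0 hη2 hlog (hrel j)
  obtain ⟨hV0, hV1, hV2⟩ := hΔV j
  simp only [QuadFlowParams.flow_apply_zero, QuadFlowParams.flow_apply_one, QuadFlowParams.flow_apply_two] at hV0 hV1 hV2
  have hq2 : 0 ≤ gbar P.β g₀ j ^ 2 * |Real.log (gbar P.β g₀ j)| := by positivity
  refine ⟨?_, ?_, ?_, ?_⟩
  · -- `𝒦`: `‖K_j - K̄_j(g₀)‖ ≤ b(a-a_*)χ_jḡ_j(g)³ + Aχ_jḡ_j(g₀)³ ≤ β(a-a_*)χ_jḡ_j(g₀)³`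
    have hfac : b * (1 + 7 * η) + A / (a - aStar) ≤ β := by
      have e1 : A / (a - aStar) = 4 * M * KV / (g₀ * (1 - θ) * (a - aStar)) * δ := by
        rw [hAeq]; field_simp
      have hηb0 : 0 ≤ η * b := mul_nonneg hη0 hb0
      have e2 : b * (1 + 7 * η) ≤ b + 13 * 18 * b / g₀ * δ := by
        rw [← hηb]; linarith only [hηb0]
      linarith only [hS12, e1, e2]
    calc ‖(x j).1 - Kbar ψ (P.flow g₀) K₀ j‖
        ≤ ‖(x j).1 - Kbar ψ (P.flow g) K₀ j‖ + ‖Kbar ψ (P.flow g) K₀ j - Kbar ψ (P.flow g₀) K₀ j‖ := norm_sub_le_norm_sub_add_norm_sub _ _ _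
      _ ≤ b * (a - aStar) * cutoffWeight Ω k j * gbar P.β g j ^ 3 + A * (cutoffWeight Ω k j * gbar P.β g₀ j ^ 3) :=
          add_le_add b1 (hKΔ j)
      _ ≤ b * (a - aStar) * cutoffWeight Ω k j * ((1 + 7 * η) * gbar P.β g₀ j ^ 3) + A * (cutoffWeight Ω k j * gbar P.β g₀ j ^ 3) := by
          gcongr
      _ = (b * (1 + 7 * η) + A / (a - aStar)) * ((a - aStar) * cutoffWeight Ω k j * gbar P.β g₀ j ^ 3) := by
          field_simp
      _ ≤ β * ((a - aStar) * cutoffWeight Ω k j * gbar P.β g₀ j ^ 3) := mul_le_mul_of_nonneg_right hfac (by positivity)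
      _ = β * (a - aStar) * cutoffWeight Ω k j * gbar P.β g₀ j ^ 3 := by ring
  · -- `g`: `|g_j - ḡ_j(g₀)| ≤ b𝗁ḡ_j(g)²|log ḡ_j(g)| + 9ḡ_j(g₀)²δ/g₀²`
    have hfac : b * (1 + 13 * η) + 18 * δ / (g₀ ^ 2 * hh) ≤ β := by
      have e2 : b * (1 + 13 * η) = b + 13 * 18 * b / g₀ * δ := by rw [← hηb]; ring
      have e3 : 18 * δ / (g₀ ^ 2 * hh) ≤ (18 + 2 * KV) / (g₀ ^ 2 * hh) * δ := by
        rw [div_mul_eq_mul_div]; apply div_le_div_of_nonneg_right _ (by positivity)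
        nlinarith only [hKV0, hδ0]
      linarith only [hS13, e2, e3]
    have h9 : 9 * (gbar P.β g₀ j ^ 2 / g₀ ^ 2) * δ ≤ 18 * δ / (g₀ ^ 2 * hh) * (hh * (gbar P.β g₀ j ^ 2 * |Real.log (gbar P.β g₀ j)|)) := by
      have : 9 * (gbar P.β g₀ j ^ 2 / g₀ ^ 2) * δ = 18 * δ / (g₀ ^ 2 * hh) * (hh * (gbar P.β g₀ j ^ 2 * (1 / 2))) := by
        field_simp; ring
      rw [this]; gcongr
    calc |(x j).2 0 - gbar P.β g₀ j|
        ≤ |(x j).2 0 - gbar P.β g j| + |gbar P.β g j - gbar P.β g₀ j| := abs_sub_le _ _ _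
      _ ≤ b * hh * gbar P.β g j ^ 2 * |Real.log (gbar P.β g j)| + 9 * (gbar P.β g₀ j ^ 2 / g₀ ^ 2) * δ := add_le_add b2 hV0
      _ = b * hh * (gbar P.β g j ^ 2 * |Real.log (gbar P.β g j)|) + 9 * (gbar P.β g₀ j ^ 2 / g₀ ^ 2) * δ := by ring
      _ ≤ b * hh * ((1 + 13 * η) * (gbar P.β g₀ j ^ 2 * |Real.log (gbar P.β g₀ j)|)) +
            18 * δ / (g₀ ^ 2 * hh) * (hh * (gbar P.β g₀ j ^ 2 * |Real.log (gbar P.β g₀ j)|)) := by gcongr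
      _ = (b * (1 + 13 * η) + 18 * δ / (g₀ ^ 2 * hh)) * (hh * (gbar P.β g₀ j ^ 2 * |Real.log (gbar P.β g₀ j)|)) := by ring
      _ ≤ β * (hh * (gbar P.β g₀ j ^ 2 * |Real.log (gbar P.β g₀ j)|)) := mul_le_mul_of_nonneg_right hfac (by positivity)
      _ = β * hh * gbar P.β g₀ j ^ 2 * |Real.log (gbar P.β g₀ j)| := by ring
  · -- `z`
    have hfac : b * (1 + 13 * η) + 2 * KV * δ / (g₀ ^ 2 * hh) ≤ β := by
      have e2 : b * (1 + 13 * η) = b + 13 * 18 * b / g₀ * δ := by rw [← hηb]; ring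
      have e3 : 2 * KV * δ / (g₀ ^ 2 * hh) ≤ (18 + 2 * KV) / (g₀ ^ 2 * hh) * δ := by
        rw [div_mul_eq_mul_div]; apply div_le_div_of_nonneg_right _ (by positivity)
        nlinarith only [hKV0, hδ0]
      linarith only [hS13, e2, e3]
    have hz : zLipConst Ω c N C * (cutoffWeight Ω k j * gbar P.β g₀ j ^ 2) * (δ / g₀ ^ 2) ≤
        2 * KV * δ / (g₀ ^ 2 * hh) * (hh * cutoffWeight Ω k j * (gbar P.β g₀ j ^ 2 * |Real.log (gbar P.β g₀ j)|)) := by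
      calc _ ≤ KV * (cutoffWeight Ω k j * gbar P.β g₀ j ^ 2) * (δ / g₀ ^ 2) := by gcongr
        _ = 2 * KV * δ / (g₀ ^ 2 * hh) * (hh * cutoffWeight Ω k j * (gbar P.β g₀ j ^ 2 * (1 / 2))) := by
            field_simp
        _ ≤ _ := by gcongr
    calc |(x j).2 1 - P.zbar g₀ j|
        ≤ |(x j).2 1 - P.zbar g j| + |P.zbar g j - P.zbar g₀ j| := abs_sub_le _ _ _
      _ ≤ b * hh * cutoffWeight Ω k j * gbar P.β g j ^ 2 * |Real.log (gbar P.β g j)| +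
            zLipConst Ω c N C * (cutoffWeight Ω k j * gbar P.β g₀ j ^ 2) * (δ / g₀ ^ 2) := add_le_add b3 hV1
      _ = b * hh * cutoffWeight Ω k j * (gbar P.β g j ^ 2 * |Real.log (gbar P.β g j)|) +
            zLipConst Ω c N C * (cutoffWeight Ω k j * gbar P.β g₀ j ^ 2) * (δ / g₀ ^ 2) := by ring
      _ ≤ b * hh * cutoffWeight Ω k j * ((1 + 13 * η) * (gbar P.β g₀ j ^ 2 * |Real.log (gbar P.β g₀ j)|)) +
            2 * KV * δ / (g₀ ^ 2 * hh) * (hh * cutoffWeight Ω k j * (gbar P.β g₀ j ^ 2 * |Real.log (gbar P.β g₀ j)|)) := by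
          gcongr
      _ = (b * (1 + 13 * η) + 2 * KV * δ / (g₀ ^ 2 * hh)) *
            (hh * cutoffWeight Ω k j * (gbar P.β g₀ j ^ 2 * |Real.log (gbar P.β g₀ j)|)) := by ring
      _ ≤ β * (hh * cutoffWeight Ω k j * (gbar P.β g₀ j ^ 2 * |Real.log (gbar P.β g₀ j)|)) :=
          mul_le_mul_of_nonneg_right hfac (by positivity)
      _ = β * hh * cutoffWeight Ω k j * gbar P.β g₀ j ^ 2 * |Real.log (gbar P.β g₀ j)| := by ring
  · -- `μ`
    have hfac : b * (1 + 13 * η) + 2 * KV * δ / (g₀ ^ 2 * hh) ≤ β := by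
      have e2 : b * (1 + 13 * η) = b + 13 * 18 * b / g₀ * δ := by rw [← hηb]; ring
      have e3 : 2 * KV * δ / (g₀ ^ 2 * hh) ≤ (18 + 2 * KV) / (g₀ ^ 2 * hh) * δ := by
        rw [div_mul_eq_mul_div]; apply div_le_div_of_nonneg_right _ (by positivity)
        nlinarith only [hKV0, hδ0]
      linarith only [hS13, e2, e3]
    have hμb : muLipConst Ω c N C lam * (cutoffWeight Ω k j * gbar P.β g₀ j ^ 2) * (δ / g₀ ^ 2) ≤
        2 * KV * δ / (g₀ ^ 2 * hh) * (hh * cutoffWeight Ω k j * (gbar P.β g₀ j ^ 2 * |Real.log (gbar P.β g₀ j)|)) := by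
      have hKμ0 := h.muLipConst_nonneg
      calc _ ≤ KV * (cutoffWeight Ω k j * gbar P.β g₀ j ^ 2) * (δ / g₀ ^ 2) := by gcongr
        _ = 2 * KV * δ / (g₀ ^ 2 * hh) * (hh * cutoffWeight Ω k j * (gbar P.β g₀ j ^ 2 * (1 / 2))) := by
            field_simp
        _ ≤ _ := by gcongr
    calc |(x j).2 2 - P.mubar g₀ j|
        ≤ |(x j).2 2 - P.mubar g j| + |P.mubar g j - P.mubar g₀ j| := abs_sub_le _ _ _
      _ ≤ b * hh * cutoffWeight Ω k j * gbar P.β g j ^ 2 * |Real.log (gbar P.β g j)| +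
            muLipConst Ω c N C lam * (cutoffWeight Ω k j * gbar P.β g₀ j ^ 2) * (δ / g₀ ^ 2) := add_le_add b4 hV2
      _ = b * hh * cutoffWeight Ω k j * (gbar P.β g j ^ 2 * |Real.log (gbar P.β g j)|) +
            muLipConst Ω c N C lam * (cutoffWeight Ω k j * gbar P.β g₀ j ^ 2) * (δ / g₀ ^ 2) := by ring
      _ ≤ b * hh * cutoffWeight Ω k j * ((1 + 13 * η) * (gbar P.β g₀ j ^ 2 * |Real.log (gbar P.β g₀ j)|)) +
            2 * KV * δ / (g₀ ^ 2 * hh) * (hh * cutoffWeight Ω k j * (gbar P.β g₀ j ^ 2 * |Real.log (gbar P.β g₀ j)|)) := by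
          gcongr
      _ = (b * (1 + 13 * η) + 2 * KV * δ / (g₀ ^ 2 * hh)) *
            (hh * cutoffWeight Ω k j * (gbar P.β g₀ j ^ 2 * |Real.log (gbar P.β g₀ j)|)) := by ring
      _ ≤ β * (hh * cutoffWeight Ω k j * (gbar P.β g₀ j ^ 2 * |Real.log (gbar P.β g₀ j)|)) :=
          mul_le_mul_of_nonneg_right hfac (by positivity)
      _ = β * hh * cutoffWeight Ω k j * gbar P.β g₀ j ^ 2 * |Real.log (gbar P.β g₀ j)| := by ring

end CutoffQuadHyp

end CTWSAW

end Literature.Barriers.CriticalPhenomena
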